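import Literature.NumberTheory.LFunctions.IdealMoebius
import Literature.NumberTheory.LFunctions.MertensPrimeIdeals
import HarnessLib

/-!
# The harmonic sum over the ideals coprime to a fixed ideal: `∑_{N𝔫 ≤ y, (𝔫,𝔠)=1} 1/N𝔫`

Topic `Literature/NumberTheory/LFunctions`, next to `IdealMoebius.lean` (Möbius function and Möbius
inversion over the ideals of a Dedekind domain) and `MertensPrimeIdeals.lean` (the harmonic sum over
all ideals, `abs_sum_idealNormCount_div_sub_log_le`). Everything in this file is PROVED.

This is the first layer of the one-dimensional sieve sums over a number field (the analogue of the
tree's `Sieve/CoprimeSquarefreeSums.lean` over `ℤ`), needed for the main terms of the Maynard–Tao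
sieve over `𝓞_K` (Castillo–Hall–Lemke Oliver–Pollack–Thompson, arXiv:1403.5808, §2.2, the sums
`∑_{N𝔲 < R, (𝔲,𝔴)=1} μ²(𝔲)/φ(𝔲)` and their relatives):

* (any Dedekind domain) `halfFactors`, `sqrtRad 𝔪 = ∏ 𝔭^{⌊v_𝔭(𝔪)/2⌋}`, `sq_dvd_iff_dvd_sqrtRad`
  (`𝔞² ∣ 𝔪 ↔ 𝔞 ∣ sqrtRad 𝔪`), `sqrtRad_eq_top_iff` (`↔ 𝔪` square-free) and the square-free sieve
  `sum_idealMoebius_of_sq_dvd`: `∑_{𝔞² ∣ 𝔪} μ(𝔞) = [𝔪 square-free]`;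
* `idealsLE K y` — the nonzero ideals of norm `≤ y` (a finset), `idealDivisors K J` — the divisors of a
  nonzero ideal; `sum_idealsLE_eq_sum_Icc` (regrouping by the norm);
* `abs_harmonic_sub_log_le` — `|∑_{0 < N𝔞 ≤ y} 1/N𝔞 − ρ_K log y| ≤ C_K` for `y ≥ 1`;
* **`sum_idealsLE_sum_filter_dvd_eq`** — regrouping by a divisor:
  `∑_{N𝔫 ≤ y} ∑_{𝔢 ∈ D, 𝔢 ∣ 𝔫} G(𝔢, 𝔫) = ∑_{𝔢 ∈ D} ∑_{N𝔫' ≤ y/N𝔢} G(𝔢, 𝔢𝔫')` (`𝔫 = 𝔢𝔫'`, cancellation);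
* `sum_idealDivisors_moebius_filter_dvd` — Möbius detection of coprimality,
  `∑_{𝔢 ∣ 𝔠, 𝔢 ∣ 𝔫} μ(𝔢) = [𝔫 + 𝔠 = (1)]` (the common divisors of `𝔫, 𝔠` are the divisors of `𝔫 + 𝔠`);
* **`abs_coprimeHarmonic_sub_le`** — for `𝔠 ≠ 0`, `y ≥ 1`:
  `|∑_{N𝔫 ≤ y, 𝔫+𝔠=(1)} 1/N𝔫 − ρ_K (∑_{𝔢∣𝔠} μ(𝔢)/N𝔢) log y| ≤ ∑_{𝔢 ∣ 𝔠} (C_K + ρ_K log N𝔢)/N𝔢`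
  (`∑_{𝔢∣𝔠} μ(𝔢)/N𝔢 = ∏_{𝔭∣𝔠}(1 − 1/N𝔭) = φ(𝔠)/N𝔠`);
* **`abs_sqfreeCoprimeHarmonic_sub_le`** — the square-free version:
  `∑_{N𝔪 ≤ y, (𝔪,𝔠)=1, 𝔪 sq-free} 1/N𝔪 = ρ_K d(𝔠) s_y(𝔠) log y + O(e(𝔠) + |d(𝔠)|)` with the partial
  singular series `s_y(𝔠) = ∑_{N𝔞² ≤ y, (𝔞,𝔠)=1} μ(𝔞)/N𝔞²` (regrouping `𝔪 = 𝔞²𝔫'` by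
  `sum_idealsLE_sum_filter_map_dvd_eq`).

## References

* H. Halberstam, H.-E. Richert, *Sieve Methods*, Academic Press 1974, Ch. 3, (3.1.11) (the prototype
  over `ℤ`). [folklore]
* A. Castillo et al., arXiv:1403.5808, §2.2 (the consumer). [CastilloEtAl2015]
-/

noncomputable section

open Finset
open scoped NumberField Classical

namespace Literature.NumberTheory.LFunctions

/-! ## The square-free sieve over a Dedekind domain: `∑_{𝔞² ∣ 𝔪} μ(𝔞) = [𝔪 square-free]` -/

section Dedekind

open UniqueFactorizationMonoid

variable {R : Type*} [CommRing R] [IsDedekindDomain R]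

/-- The multiset of prime factors of `𝔪` with halved multiplicities `⌊v_P(𝔪)/2⌋`. [folklore] -/
def halfFactors (𝔪 : Ideal R) : Multiset (Ideal R) :=
  (normalizedFactors 𝔪).toFinset.val.bind
    fun P => Multiset.replicate (Multiset.count P (normalizedFactors 𝔪) / 2) P

/-- `sqrtRad 𝔪 = ∏_P P^{⌊v_P(𝔪)/2⌋}`, the largest ideal whose square divides `𝔪`. [folklore] -/
def sqrtRad (𝔪 : Ideal R) : Ideal R := (halfFactors 𝔪).prod

/-- Multiplicities in `halfFactors`. [folklore] -/
theorem count_halfFactors (𝔪 P : Ideal R) :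
    Multiset.count P (halfFactors 𝔪) = Multiset.count P (normalizedFactors 𝔪) / 2 := by
  rw [halfFactors, Multiset.count_bind, ← Finset.sum_eq_multiset_sum]
  simp only [Multiset.count_replicate]
  rw [Finset.sum_ite_eq']
  split_ifs with h
  · rfl
  · rw [Multiset.mem_toFinset] at h
    rw [Multiset.count_eq_zero_of_notMem h]
    rfl

/-- Every element of `halfFactors 𝔪` is a prime factor of `𝔪`. [folklore] -/
theorem prime_of_mem_halfFactors {𝔪 P : Ideal R} (hP : P ∈ halfFactors 𝔪) : Prime P := by
  rw [halfFactors, Multiset.mem_bind] at hP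
  obtain ⟨Q, hQ, hPQ⟩ := hP
  rw [Multiset.eq_of_mem_replicate hPQ]
  exact prime_of_normalized_factor Q (Multiset.mem_toFinset.1 hQ)

/-- `normalizedFactors (sqrtRad 𝔪) = halfFactors 𝔪`. [folklore] -/
theorem normalizedFactors_sqrtRad (𝔪 : Ideal R) :
    normalizedFactors (sqrtRad 𝔪) = halfFactors 𝔪 :=
  normalizedFactors_prod_of_prime fun _ hP => prime_of_mem_halfFactors hP

/-- `sqrtRad 𝔪 ≠ 0`. [folklore] -/
theorem sqrtRad_ne_bot (𝔪 : Ideal R) : sqrtRad 𝔪 ≠ ⊥ := by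
  rw [sqrtRad, Ne, ← Ideal.zero_eq_bot, Multiset.prod_eq_zero_iff]
  exact fun h => (prime_of_mem_halfFactors h).ne_zero rfl

/-- **`𝔞² ∣ 𝔪 ↔ 𝔞 ∣ sqrtRad 𝔪`** for `𝔪 ≠ 0` (compare multiplicities: `2 v_P(𝔞) ≤ v_P(𝔪)` iff
`v_P(𝔞) ≤ ⌊v_P(𝔪)/2⌋`). [folklore] -/
theorem sq_dvd_iff_dvd_sqrtRad {𝔪 𝔞 : Ideal R} (h𝔪 : 𝔪 ≠ ⊥) : 𝔞 ^ 2 ∣ 𝔪 ↔ 𝔞 ∣ sqrtRad 𝔪 := by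
  by_cases h𝔞 : 𝔞 = ⊥
  · subst h𝔞
    have h1 : ¬ (⊥ : Ideal R) ^ 2 ∣ 𝔪 := by
      rw [← Ideal.zero_eq_bot, zero_pow two_ne_zero, zero_dvd_iff, Ideal.zero_eq_bot]; exact h𝔪
    have h2 : ¬ (⊥ : Ideal R) ∣ sqrtRad 𝔪 := by
      rw [← Ideal.zero_eq_bot, zero_dvd_iff, Ideal.zero_eq_bot]; exact sqrtRad_ne_bot 𝔪
    exact ⟨fun h => absurd h h1, fun h => absurd h h2⟩
  have h𝔞0 : (𝔞 : Ideal R) ≠ 0 := by rwa [Ne, Ideal.zero_eq_bot]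
  have h𝔪0 : (𝔪 : Ideal R) ≠ 0 := by rwa [Ne, Ideal.zero_eq_bot]
  have hr0 : sqrtRad 𝔪 ≠ 0 := by rw [Ne, Ideal.zero_eq_bot]; exact sqrtRad_ne_bot 𝔪
  rw [dvd_iff_normalizedFactors_le_normalizedFactors (pow_ne_zero 2 h𝔞0) h𝔪0,
    dvd_iff_normalizedFactors_le_normalizedFactors h𝔞0 hr0, normalizedFactors_pow,
    normalizedFactors_sqrtRad, Multiset.le_iff_count, Multiset.le_iff_count]
  refine forall_congr' fun P => ?_
  rw [Multiset.count_nsmul, count_halfFactors]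
  omega

/-- **`sqrtRad 𝔪 = (1) ↔ 𝔪` is square-free** (`𝔪 ≠ 0`). [folklore] -/
theorem sqrtRad_eq_top_iff {𝔪 : Ideal R} (h𝔪 : 𝔪 ≠ ⊥) : sqrtRad 𝔪 = ⊤ ↔ Squarefree 𝔪 := by
  have h𝔪0 : (𝔪 : Ideal R) ≠ 0 := by rwa [Ne, Ideal.zero_eq_bot]
  have hr0 : sqrtRad 𝔪 ≠ 0 := by rw [Ne, Ideal.zero_eq_bot]; exact sqrtRad_ne_bot 𝔪
  rw [squarefree_iff_nodup_normalizedFactors h𝔪0, Multiset.nodup_iff_count_le_one,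
    ← Ideal.isUnit_iff, ← normalizedFactors_eq_zero_iff hr0, normalizedFactors_sqrtRad,
    Multiset.ext]
  refine forall_congr' fun P => ?_
  rw [count_halfFactors, Multiset.count_zero]
  omega

/-- **`∑_{𝔞² ∣ 𝔪} μ(𝔞) = [𝔪 square-free]`** over the ideals of a Dedekind domain (`𝔪 ≠ 0`): the
`𝔞` with `𝔞² ∣ 𝔪` are the divisors of `sqrtRad 𝔪`, and `∑_{𝔞 ∣ 𝔯} μ(𝔞) = [𝔯 = (1)]`
(`sum_idealMoebius_of_dvd`). [folklore] -/
theorem sum_idealMoebius_of_sq_dvd {𝔪 : Ideal R} (h𝔪 : 𝔪 ≠ ⊥) {D : Finset (Ideal R)}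
    (hD : ∀ 𝔞, 𝔞 ∈ D ↔ 𝔞 ^ 2 ∣ 𝔪) :
    ∑ 𝔞 ∈ D, idealMoebius 𝔞 = if Squarefree 𝔪 then 1 else 0 := by
  have hD' : ∀ 𝔞, 𝔞 ∈ D ↔ 𝔞 ∣ sqrtRad 𝔪 := fun 𝔞 => (hD 𝔞).trans (sq_dvd_iff_dvd_sqrtRad h𝔪)
  rw [sum_idealMoebius_of_dvd (sqrtRad_ne_bot 𝔪) hD']
  by_cases h : Squarefree 𝔪
  · rw [if_pos h, if_pos ((sqrtRad_eq_top_iff h𝔪).2 h)]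
  · rw [if_neg h, if_neg (fun h' => h ((sqrtRad_eq_top_iff h𝔪).1 h'))]


end Dedekind

end Literature.NumberTheory.LFunctions

namespace Literature.NumberTheory.LFunctions.NumberField

variable (K : Type*) [Field K] [NumberField K]

/-! ### Nonzero ideals of bounded norm; divisors -/

/-- The nonzero ideals of `𝓞 K` of absolute norm `≤ y`. [folklore] -/
def idealsLE (y : ℝ) : Finset (Ideal (𝓞 K)) :=
  ((Ideal.finite_setOf_absNorm_le (S := 𝓞 K) ⌊y⌋₊).toFinset).filter (· ≠ ⊥)

variable {K} in
/-- Membership in `idealsLE`. [folklore] -/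
theorem mem_idealsLE {y : ℝ} {I : Ideal (𝓞 K)} :
    I ∈ idealsLE K y ↔ I ≠ ⊥ ∧ (Ideal.absNorm I : ℝ) ≤ y := by
  rw [idealsLE, Finset.mem_filter, Set.Finite.mem_toFinset, Set.mem_setOf_eq]
  constructor
  · rintro ⟨hle, hne⟩
    refine ⟨hne, ?_⟩
    have h1 : 1 ≤ Ideal.absNorm I :=
      Nat.one_le_iff_ne_zero.2 (by rwa [Ne, Ideal.absNorm_eq_zero_iff])
    have hy : 0 ≤ y := by
      by_contra hy
      rw [Nat.floor_of_nonpos (le_of_lt (not_le.1 hy))] at hle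
      omega
    exact le_trans (by exact_mod_cast hle) (Nat.floor_le hy)
  · rintro ⟨hne, hle⟩
    exact ⟨Nat.le_floor hle, hne⟩

variable {K} in
/-- Elements of `idealsLE` have norm `≥ 1`. [folklore] -/
theorem one_le_absNorm_of_mem_idealsLE {y : ℝ} {I : Ideal (𝓞 K)} (h : I ∈ idealsLE K y) :
    (1 : ℝ) ≤ Ideal.absNorm I := by
  have := (mem_idealsLE.1 h).1
  exact_mod_cast Nat.one_le_iff_ne_zero.2 (by rwa [Ne, Ideal.absNorm_eq_zero_iff])

/-- The divisors of a nonzero ideal, as a finset (the ideals of norm in `[1, N J]` dividing `J`, as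
in `IdealMoebius.mem_filter_dvd_iff`). [folklore] -/
def idealDivisors (J : Ideal (𝓞 K)) : Finset (Ideal (𝓞 K)) :=
  ((Finset.Icc 1 (Ideal.absNorm J)).biUnion (idealsOfNorm K)).filter (· ∣ J)

variable {K} in
/-- Membership in `idealDivisors` for `J ≠ 0`. [folklore] -/
theorem mem_idealDivisors {J B : Ideal (𝓞 K)} (hJ : J ≠ ⊥) : B ∈ idealDivisors K J ↔ B ∣ J :=
  mem_filter_dvd_iff hJ

variable {K} in
/-- Divisors of a nonzero ideal are nonzero. [folklore] -/
theorem ne_bot_of_mem_idealDivisors {J B : Ideal (𝓞 K)} (hJ : J ≠ ⊥) (hB : B ∈ idealDivisors K J) :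
    B ≠ ⊥ := by
  rintro rfl
  have := (mem_idealDivisors hJ).1 hB
  rw [Ideal.dvd_iff_le, le_bot_iff] at this
  exact hJ this

/-- Regrouping a sum over `idealsLE` by the norm: `∑_{0 < N𝔞 ≤ y} f(N𝔞) = ∑_{1 ≤ n ≤ y} c_K(n) f(n)`.
[folklore] -/
theorem sum_idealsLE_eq_sum_Icc (f : ℕ → ℝ) (y : ℝ) :
    ∑ 𝔞 ∈ idealsLE K y, f (Ideal.absNorm 𝔞) = ∑ n ∈ Icc 1 ⌊y⌋₊, (idealNormCount K n : ℝ) * f n := by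
  rw [← Finset.sum_fiberwise_of_maps_to (s := idealsLE K y) (t := Icc 1 ⌊y⌋₊)
    (g := fun 𝔞 => Ideal.absNorm 𝔞) (fun 𝔞 h𝔞 => ?_)]
  · refine Finset.sum_congr rfl fun n hn => ?_
    have hn1 : 1 ≤ n := (Finset.mem_Icc.1 hn).1
    have hfil : (idealsLE K y).filter (fun 𝔞 => Ideal.absNorm 𝔞 = n) = idealsOfNorm K n := by
      ext 𝔞
      rw [Finset.mem_filter, mem_idealsOfNorm, idealsLE, Finset.mem_filter, Set.Finite.mem_toFinset,
        Set.mem_setOf_eq]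
      constructor
      · exact fun h => h.2
      · intro h
        refine ⟨⟨by rw [h]; exact (Finset.mem_Icc.1 hn).2, ?_⟩, h⟩
        rw [Ne, ← Ideal.absNorm_eq_zero_iff, h]; omega
    rw [Finset.sum_congr rfl fun 𝔞 h𝔞 => by rw [(Finset.mem_filter.1 h𝔞).2], Finset.sum_const, hfil,
      card_idealsOfNorm, nsmul_eq_mul]
  · rw [idealsLE, Finset.mem_filter, Set.Finite.mem_toFinset, Set.mem_setOf_eq] at h𝔞
    exact Finset.mem_Icc.2 ⟨Nat.one_le_iff_ne_zero.2 (by rw [Ne, Ideal.absNorm_eq_zero_iff]; exact h𝔞.2),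
      h𝔞.1⟩

/-- **The harmonic sum over all nonzero ideals**, as a sum over ideals and for all `y ≥ 1`:
`|∑_{0 < N𝔞 ≤ y} 1/N𝔞 − ρ_K log y| ≤ C_K`. [cite: MontgomeryVaughan2007, (8.43) p. 266] -/
theorem abs_harmonic_sub_log_le :
    ∃ C : ℝ, ∀ y : ℝ, 1 ≤ y →
      |∑ 𝔞 ∈ idealsLE K y, ((Ideal.absNorm 𝔞 : ℕ) : ℝ)⁻¹ -
          NumberField.dedekindZeta_residue K * Real.log y| ≤ C := by
  obtain ⟨C, hC⟩ := abs_sum_idealNormCount_div_sub_log_le K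
  have hρ := NumberField.dedekindZeta_residue_pos K
  refine ⟨max C (1 + NumberField.dedekindZeta_residue K * Real.log 2), fun y hy => ?_⟩
  rw [sum_idealsLE_eq_sum_Icc K (fun n => ((n : ℕ) : ℝ)⁻¹) y]
  simp_rw [← div_eq_mul_inv]
  rcases le_or_gt 2 y with h2 | h2
  · exact (hC y h2).trans (le_max_left _ _)
  · -- `1 ≤ y < 2`: the sum is the single term `n = 1`
    have hfl : ⌊y⌋₊ = 1 := by
      rw [Nat.floor_eq_iff (by linarith)]; constructor <;> push_cast <;> linarith
    rw [hfl, Finset.Icc_self, Finset.sum_singleton, idealNormCount_one]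
    refine le_trans ?_ (le_max_right _ _)
    have hlog : 0 ≤ Real.log y := Real.log_nonneg hy
    have hlog2 : Real.log y ≤ Real.log 2 := Real.log_le_log (by linarith) h2.le
    rw [abs_le]
    constructor <;> push_cast <;> nlinarith [mul_nonneg hρ.le hlog, mul_le_mul_of_nonneg_left hlog2 hρ.le]

/-! ### Regrouping by a divisor -/

variable {K} in
/-- **Regrouping by a divisor** (Dirichlet's rearrangement over ideals): for a finset `D` of nonzero
ideals and any `G`,
`∑_{0 < N𝔫 ≤ y} ∑_{𝔢 ∈ D, 𝔢 ∣ 𝔫} G(𝔢, 𝔫) = ∑_{𝔢 ∈ D} ∑_{0 < N𝔫' ≤ y/N𝔢} G(𝔢, 𝔢𝔫')`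
(the pairs `(𝔫, 𝔢)` with `𝔢 ∣ 𝔫` are the pairs `(𝔢, 𝔫')`, `𝔫 = 𝔢𝔫'`, by cancellation of nonzero
ideals, and `N(𝔢𝔫') = N𝔢 · N𝔫'`). [folklore] -/
theorem sum_idealsLE_sum_filter_dvd_eq {M : Type*} [AddCommMonoid M] {D : Finset (Ideal (𝓞 K))}
    (hD : ∀ 𝔢 ∈ D, 𝔢 ≠ ⊥) (G : Ideal (𝓞 K) → Ideal (𝓞 K) → M) (y : ℝ) :
    ∑ 𝔫 ∈ idealsLE K y, ∑ 𝔢 ∈ D.filter (· ∣ 𝔫), G 𝔢 𝔫 =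
      ∑ 𝔢 ∈ D, ∑ 𝔫' ∈ idealsLE K (y / Ideal.absNorm 𝔢), G 𝔢 (𝔢 * 𝔫') := by
  rw [Finset.sum_sigma', Finset.sum_sigma']
  symm
  refine Finset.sum_bij (fun z _ => (⟨z.1 * z.2, z.1⟩ : Σ _ : Ideal (𝓞 K), Ideal (𝓞 K))) ?_ ?_ ?_ ?_
  · rintro ⟨𝔢, 𝔫'⟩ hz
    simp only [Finset.mem_sigma] at hz ⊢
    obtain ⟨h𝔢, h𝔫'⟩ := hz
    rw [mem_idealsLE] at h𝔫'
    have h𝔢0 := hD 𝔢 h𝔢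
    have hN𝔢 : (0 : ℝ) < Ideal.absNorm 𝔢 := by
      exact_mod_cast Nat.pos_of_ne_zero (by rwa [Ne, Ideal.absNorm_eq_zero_iff])
    refine ⟨mem_idealsLE.2 ⟨?_, ?_⟩, Finset.mem_filter.2 ⟨h𝔢, dvd_mul_right _ _⟩⟩
    · exact mul_ne_zero h𝔢0 h𝔫'.1
    · rw [map_mul, Nat.cast_mul]
      calc (Ideal.absNorm 𝔢 : ℝ) * Ideal.absNorm 𝔫' ≤ Ideal.absNorm 𝔢 * (y / Ideal.absNorm 𝔢) :=
            mul_le_mul_of_nonneg_left h𝔫'.2 hN𝔢.le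
        _ = y := mul_div_cancel₀ _ hN𝔢.ne'
  · rintro ⟨𝔢, 𝔫'⟩ hz ⟨𝔢₁, 𝔫₁'⟩ hz₁ h
    simp only [Sigma.mk.injEq, heq_eq_eq] at h
    obtain ⟨hmul, rfl⟩ := h
    have h𝔢0 : 𝔢 ≠ 0 := hD 𝔢 (Finset.mem_sigma.1 hz).1
    rw [mul_left_cancel₀ h𝔢0 hmul]
  · rintro ⟨𝔫, 𝔢⟩ hx
    simp only [Finset.mem_sigma, Finset.mem_filter] at hx
    obtain ⟨h𝔫, h𝔢, hdvd⟩ := hx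
    obtain ⟨𝔫', rfl⟩ := hdvd
    rw [mem_idealsLE] at h𝔫
    have h𝔢0 := hD 𝔢 h𝔢
    have hN𝔢 : (0 : ℝ) < Ideal.absNorm 𝔢 := by
      exact_mod_cast Nat.pos_of_ne_zero (by rwa [Ne, Ideal.absNorm_eq_zero_iff])
    refine ⟨⟨𝔢, 𝔫'⟩, Finset.mem_sigma.2 ⟨h𝔢, mem_idealsLE.2 ⟨?_, ?_⟩⟩, rfl⟩
    · rintro rfl; exact h𝔫.1 (by simp)
    · rw [le_div_iff₀ hN𝔢, mul_comm]
      have := h𝔫.2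
      rwa [map_mul, Nat.cast_mul] at this
  · intro z _
    rfl

/-! ### Möbius detection of coprimality -/

variable {K} in
/-- The common divisors of `𝔫` and `𝔠` are the divisors of `𝔫 + 𝔠` (Dedekind: `𝔢 ∣ 𝔞 ↔ 𝔞 ≤ 𝔢`).
[folklore] -/
theorem dvd_and_dvd_iff_dvd_sup {𝔫 𝔠 𝔢 : Ideal (𝓞 K)} : 𝔢 ∣ 𝔫 ∧ 𝔢 ∣ 𝔠 ↔ 𝔢 ∣ 𝔫 ⊔ 𝔠 := by
  simp only [Ideal.dvd_iff_le, sup_le_iff]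

variable {K} in
/-- **Möbius detection of coprimality**: for `𝔠 ≠ 0` and any `𝔫`,
`∑_{𝔢 ∣ 𝔠, 𝔢 ∣ 𝔫} μ(𝔢) = 1` if `𝔫 + 𝔠 = (1)` and `= 0` otherwise (Möbius inversion
`sum_idealMoebius_of_dvd` applied to `𝔫 + 𝔠`). [folklore] -/
theorem sum_idealDivisors_moebius_filter_dvd (𝔫 : Ideal (𝓞 K)) {𝔠 : Ideal (𝓞 K)} (h𝔠 : 𝔠 ≠ ⊥) :
    ∑ 𝔢 ∈ (idealDivisors K 𝔠).filter (· ∣ 𝔫), (idealMoebius 𝔢 : ℝ) =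
      if 𝔫 ⊔ 𝔠 = ⊤ then 1 else 0 := by
  have hJ : 𝔫 ⊔ 𝔠 ≠ ⊥ := fun h => h𝔠 (le_bot_iff.1 (h ▸ le_sup_right))
  have hD : ∀ B, B ∈ (idealDivisors K 𝔠).filter (· ∣ 𝔫) ↔ B ∣ 𝔫 ⊔ 𝔠 := by
    intro B
    rw [Finset.mem_filter, mem_idealDivisors h𝔠, ← dvd_and_dvd_iff_dvd_sup, and_comm]
  have h := sum_idealMoebius_of_dvd hJ hD
  have hcast : (∑ 𝔢 ∈ (idealDivisors K 𝔠).filter (· ∣ 𝔫), (idealMoebius 𝔢 : ℝ)) =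
      ((∑ 𝔢 ∈ (idealDivisors K 𝔠).filter (· ∣ 𝔫), idealMoebius 𝔢 : ℤ) : ℝ) := by push_cast; rfl
  rw [hcast, h]
  split_ifs <;> simp

/-! ### The coprime harmonic sum -/

/-- **The harmonic sum over the ideals coprime to `𝔠`**: there is `C = C_K` such that for every
nonzero ideal `𝔠` and every `y ≥ 1`,
`|∑_{0 < N𝔫 ≤ y, 𝔫+𝔠=(1)} 1/N𝔫 − ρ_K (∑_{𝔢∣𝔠} μ(𝔢)/N𝔢) log y| ≤ ∑_{𝔢∣𝔠} (C + ρ_K log N𝔢)/N𝔢`.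
(Detect `(𝔫, 𝔠) = 1` by `∑_{𝔢∣𝔠, 𝔢∣𝔫} μ(𝔢)`, regroup `𝔫 = 𝔢𝔫'`, and use the harmonic sum over all
ideals at `y/N𝔢`; the divisors with `N𝔢 > y` contribute only to the error.)
[cite: CastilloEtAl2015, §2.2 (the sums over (𝔲, 𝔴) = 1)] -/
theorem abs_coprimeHarmonic_sub_le :
    ∃ C : ℝ, ∀ 𝔠 : Ideal (𝓞 K), 𝔠 ≠ ⊥ → ∀ y : ℝ, 1 ≤ y →
      |∑ 𝔫 ∈ (idealsLE K y).filter (fun 𝔫 => 𝔫 ⊔ 𝔠 = ⊤), ((Ideal.absNorm 𝔫 : ℕ) : ℝ)⁻¹ -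
          NumberField.dedekindZeta_residue K *
            (∑ 𝔢 ∈ idealDivisors K 𝔠, (idealMoebius 𝔢 : ℝ) / Ideal.absNorm 𝔢) * Real.log y| ≤
        ∑ 𝔢 ∈ idealDivisors K 𝔠,
          (C + NumberField.dedekindZeta_residue K * Real.log (Ideal.absNorm 𝔢)) / Ideal.absNorm 𝔢 := by
  obtain ⟨C, hC⟩ := abs_harmonic_sub_log_le K
  set ρ : ℝ := NumberField.dedekindZeta_residue K with hρ
  have hρ0 : 0 < ρ := NumberField.dedekindZeta_residue_pos K
  have hC0 : 0 ≤ C := by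
    have := hC 1 le_rfl
    exact (abs_nonneg _).trans this
  refine ⟨C, fun 𝔠 h𝔠 y hy => ?_⟩
  set D := idealDivisors K 𝔠 with hDdef
  have hD0 : ∀ 𝔢 ∈ D, 𝔢 ≠ ⊥ := fun 𝔢 h𝔢 => ne_bot_of_mem_idealDivisors h𝔠 h𝔢
  -- Step 1: detect coprimality and regroup
  have hdetect : ∑ 𝔫 ∈ (idealsLE K y).filter (fun 𝔫 => 𝔫 ⊔ 𝔠 = ⊤), ((Ideal.absNorm 𝔫 : ℕ) : ℝ)⁻¹ =
      ∑ 𝔫 ∈ idealsLE K y, ∑ 𝔢 ∈ D.filter (· ∣ 𝔫),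
        (idealMoebius 𝔢 : ℝ) * ((Ideal.absNorm 𝔫 : ℕ) : ℝ)⁻¹ := by
    rw [Finset.sum_filter]
    refine Finset.sum_congr rfl fun 𝔫 _ => ?_
    rw [← Finset.sum_mul, sum_idealDivisors_moebius_filter_dvd 𝔫 h𝔠]
    split_ifs <;> simp
  have hregroup := sum_idealsLE_sum_filter_dvd_eq hD0
    (fun 𝔢 𝔫 => (idealMoebius 𝔢 : ℝ) * ((Ideal.absNorm 𝔫 : ℕ) : ℝ)⁻¹) y
  rw [hdetect, hregroup]
  -- Step 2: each inner sum is `μ(𝔢)/N𝔢 · H(y/N𝔢)`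
  have hinner : ∀ 𝔢 ∈ D, ∑ 𝔫' ∈ idealsLE K (y / Ideal.absNorm 𝔢),
      (idealMoebius 𝔢 : ℝ) * ((Ideal.absNorm (𝔢 * 𝔫') : ℕ) : ℝ)⁻¹ =
      (idealMoebius 𝔢 : ℝ) / Ideal.absNorm 𝔢 *
        ∑ 𝔫' ∈ idealsLE K (y / Ideal.absNorm 𝔢), ((Ideal.absNorm 𝔫' : ℕ) : ℝ)⁻¹ := by
    intro 𝔢 _
    rw [Finset.mul_sum]
    refine Finset.sum_congr rfl fun 𝔫' _ => ?_
    rw [map_mul, Nat.cast_mul, mul_inv, div_eq_mul_inv]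
    ring
  rw [Finset.sum_congr rfl hinner]
  -- Step 3: compare termwise with `μ(𝔢)/N𝔢 · ρ log y`
  rw [Finset.mul_sum, Finset.sum_mul, ← Finset.sum_sub_distrib]
  refine (Finset.abs_sum_le_sum_abs _ _).trans (Finset.sum_le_sum fun 𝔢 h𝔢 => ?_)
  have hN : (1 : ℝ) ≤ Ideal.absNorm 𝔢 := by
    exact_mod_cast Nat.one_le_iff_ne_zero.2 (by
      rw [Ne, Ideal.absNorm_eq_zero_iff]; exact hD0 𝔢 h𝔢)
  have hN0 : (0 : ℝ) < Ideal.absNorm 𝔢 := by linarith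
  have hμ : |(idealMoebius 𝔢 : ℝ)| ≤ 1 := by exact_mod_cast abs_idealMoebius_le_one 𝔢
  set H : ℝ := ∑ 𝔫' ∈ idealsLE K (y / Ideal.absNorm 𝔢), ((Ideal.absNorm 𝔫' : ℕ) : ℝ)⁻¹ with hH
  have hHnonneg : 0 ≤ H := Finset.sum_nonneg fun 𝔫' _ => by positivity
  -- the key scalar estimate: `|H(y/N𝔢) − ρ log y| ≤ C + ρ log N𝔢`
  have hkey : |H - ρ * Real.log y| ≤ C + ρ * Real.log (Ideal.absNorm 𝔢) := by
    rcases le_or_gt (Ideal.absNorm 𝔢 : ℝ) y with hle | hgt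
    · -- `y/N𝔢 ≥ 1`: harmonic sum estimate
      have h1 : 1 ≤ y / Ideal.absNorm 𝔢 := by rwa [le_div_iff₀ hN0, one_mul]
      have h2 := hC (y / Ideal.absNorm 𝔢) h1
      rw [Real.log_div (by linarith) hN0.ne'] at h2
      have : H - ρ * Real.log y = (H - ρ * (Real.log y - Real.log (Ideal.absNorm 𝔢))) -
          ρ * Real.log (Ideal.absNorm 𝔢) := by ring
      rw [this]
      refine (abs_sub _ _).trans (add_le_add h2 ?_)
      rw [abs_of_nonneg (mul_nonneg hρ0.le (Real.log_nonneg hN))]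
    · -- `N𝔢 > y ≥ 1`: the sum is empty and `|ρ log y| ≤ ρ log N𝔢`
      have hempty : H = 0 := by
        rw [hH]
        refine Finset.sum_eq_zero fun 𝔫' h𝔫' => ?_
        exfalso
        have h1 := one_le_absNorm_of_mem_idealsLE h𝔫'
        have h2 := (mem_idealsLE.1 h𝔫').2
        have : y / Ideal.absNorm 𝔢 < 1 := by rw [div_lt_one hN0]; exact hgt
        linarith
      rw [hempty, zero_sub, abs_neg, abs_of_nonneg (mul_nonneg hρ0.le (Real.log_nonneg hy))]
      have : Real.log y ≤ Real.log (Ideal.absNorm 𝔢) := Real.log_le_log (by linarith) hgt.le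
      nlinarith
  calc |(idealMoebius 𝔢 : ℝ) / Ideal.absNorm 𝔢 * H - ρ * ((idealMoebius 𝔢 : ℝ) / Ideal.absNorm 𝔢) * Real.log y|
      = |(idealMoebius 𝔢 : ℝ)| / Ideal.absNorm 𝔢 * |H - ρ * Real.log y| := by
        rw [show (idealMoebius 𝔢 : ℝ) / Ideal.absNorm 𝔢 * H -
            ρ * ((idealMoebius 𝔢 : ℝ) / Ideal.absNorm 𝔢) * Real.log y =
            (idealMoebius 𝔢 : ℝ) / Ideal.absNorm 𝔢 * (H - ρ * Real.log y) by ring,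
          abs_mul, abs_div, abs_of_pos hN0]
    _ ≤ 1 / Ideal.absNorm 𝔢 * (C + ρ * Real.log (Ideal.absNorm 𝔢)) := by
        refine mul_le_mul ?_ hkey (abs_nonneg _) (by positivity)
        exact div_le_div_of_nonneg_right hμ hN0.le
    _ = (C + ρ * Real.log (Ideal.absNorm 𝔢)) / Ideal.absNorm 𝔢 := by ring

/-! ### The square-free coprime harmonic sum -/

variable {K} in
/-- **Regrouping by a map into divisors**: for `f 𝔞 ≠ 0` (`𝔞 ∈ A`),
`∑_{0 < N𝔫 ≤ y} ∑_{𝔞 ∈ A, f(𝔞) ∣ 𝔫} G(𝔞, 𝔫) = ∑_{𝔞 ∈ A} ∑_{0 < N𝔫' ≤ y/N(f 𝔞)} G(𝔞, f(𝔞)𝔫')`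
(used with `f 𝔞 = 𝔞²`). [folklore] -/
theorem sum_idealsLE_sum_filter_map_dvd_eq {M : Type*} [AddCommMonoid M] {A : Finset (Ideal (𝓞 K))}
    {f : Ideal (𝓞 K) → Ideal (𝓞 K)} (hf : ∀ 𝔞 ∈ A, f 𝔞 ≠ ⊥) (G : Ideal (𝓞 K) → Ideal (𝓞 K) → M)
    (y : ℝ) :
    ∑ 𝔫 ∈ idealsLE K y, ∑ 𝔞 ∈ A.filter (fun 𝔞 => f 𝔞 ∣ 𝔫), G 𝔞 𝔫 =
      ∑ 𝔞 ∈ A, ∑ 𝔫' ∈ idealsLE K (y / Ideal.absNorm (f 𝔞)), G 𝔞 (f 𝔞 * 𝔫') := by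
  rw [Finset.sum_sigma', Finset.sum_sigma']
  symm
  refine Finset.sum_bij (fun z _ => (⟨f z.1 * z.2, z.1⟩ : Σ _ : Ideal (𝓞 K), Ideal (𝓞 K))) ?_ ?_ ?_ ?_
  · rintro ⟨𝔞, 𝔫'⟩ hz
    simp only [Finset.mem_sigma] at hz ⊢
    obtain ⟨h𝔞, h𝔫'⟩ := hz
    rw [mem_idealsLE] at h𝔫'
    have h0 := hf 𝔞 h𝔞
    have hN : (0 : ℝ) < Ideal.absNorm (f 𝔞) := by
      exact_mod_cast Nat.pos_of_ne_zero (by rwa [Ne, Ideal.absNorm_eq_zero_iff])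
    refine ⟨mem_idealsLE.2 ⟨mul_ne_zero h0 h𝔫'.1, ?_⟩, Finset.mem_filter.2 ⟨h𝔞, dvd_mul_right _ _⟩⟩
    rw [map_mul, Nat.cast_mul]
    calc (Ideal.absNorm (f 𝔞) : ℝ) * Ideal.absNorm 𝔫' ≤ Ideal.absNorm (f 𝔞) * (y / Ideal.absNorm (f 𝔞)) :=
          mul_le_mul_of_nonneg_left h𝔫'.2 hN.le
      _ = y := mul_div_cancel₀ _ hN.ne'
  · rintro ⟨𝔞, 𝔫'⟩ hz ⟨𝔞₁, 𝔫₁'⟩ hz₁ h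
    simp only [Sigma.mk.injEq, heq_eq_eq] at h
    obtain ⟨hmul, rfl⟩ := h
    have h0 : f 𝔞 ≠ 0 := hf 𝔞 (Finset.mem_sigma.1 hz).1
    rw [mul_left_cancel₀ h0 hmul]
  · rintro ⟨𝔫, 𝔞⟩ hx
    simp only [Finset.mem_sigma, Finset.mem_filter] at hx
    obtain ⟨h𝔫, h𝔞, hdvd⟩ := hx
    obtain ⟨𝔫', rfl⟩ := hdvd
    rw [mem_idealsLE] at h𝔫
    have h0 := hf 𝔞 h𝔞
    have hN : (0 : ℝ) < Ideal.absNorm (f 𝔞) := by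
      exact_mod_cast Nat.pos_of_ne_zero (by rwa [Ne, Ideal.absNorm_eq_zero_iff])
    refine ⟨⟨𝔞, 𝔫'⟩, Finset.mem_sigma.2 ⟨h𝔞, mem_idealsLE.2 ⟨?_, ?_⟩⟩, rfl⟩
    · rintro rfl; exact h𝔫.1 (by simp)
    · rw [le_div_iff₀ hN, mul_comm]
      have := h𝔫.2
      rwa [map_mul, Nat.cast_mul] at this
  · intro z _
    rfl

variable {K} in
omit [NumberField K] in
/-- `(𝔞𝔟, 𝔠) = 1 ↔ (𝔞, 𝔠) = 1 ∧ (𝔟, 𝔠) = 1`. [folklore] -/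
theorem mul_sup_eq_top_iff {𝔞 𝔟 𝔠 : Ideal (𝓞 K)} : 𝔞 * 𝔟 ⊔ 𝔠 = ⊤ ↔ 𝔞 ⊔ 𝔠 = ⊤ ∧ 𝔟 ⊔ 𝔠 = ⊤ := by
  simp only [← Ideal.isCoprime_iff_sup_eq]
  exact IsCoprime.mul_left_iff

/-- `∑_{0 < N𝔞 ≤ y} N𝔞^{-s} ≤ ∑_n c_K(n) n^{-s}` (`s > 1`). [folklore] -/
theorem sum_idealsLE_rpow_neg_le {s : ℝ} (hs : 1 < s) (y : ℝ) :
    ∑ 𝔞 ∈ idealsLE K y, ((Ideal.absNorm 𝔞 : ℕ) : ℝ) ^ (-s) ≤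
      ∑' n, LogEulerProduct.term (idealNormCount K) s n := by
  rw [sum_idealsLE_eq_sum_Icc K (fun n => ((n : ℕ) : ℝ) ^ (-s)) y]
  have hterm : ∀ n, (idealNormCount K n : ℝ) * ((n : ℕ) : ℝ) ^ (-s) =
      LogEulerProduct.term (idealNormCount K) s n := fun n => rfl
  simp_rw [hterm]
  exact (summable_term_idealNormCount K hs).sum_le_tsum _ fun n _ => by
    unfold LogEulerProduct.term; positivity

/-- `∑_{0 < N𝔞 ≤ y} log N𝔞/N𝔞² ≤ 2 ∑_n c_K(n) n^{-3/2}` (`log n ≤ 2√n`). [folklore] -/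
theorem sum_idealsLE_log_div_sq_le (y : ℝ) :
    ∑ 𝔞 ∈ idealsLE K y, Real.log (Ideal.absNorm 𝔞) / ((Ideal.absNorm 𝔞 : ℕ) : ℝ) ^ 2 ≤
      2 * ∑' n, LogEulerProduct.term (idealNormCount K) (3 / 2) n := by
  have h32 : (1 : ℝ) < 3 / 2 := by norm_num
  refine le_trans ?_ (mul_le_mul_of_nonneg_left (sum_idealsLE_rpow_neg_le K h32 y) zero_le_two)
  rw [Finset.mul_sum]
  refine Finset.sum_le_sum fun 𝔞 h𝔞 => ?_
  have hN := one_le_absNorm_of_mem_idealsLE h𝔞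
  have hN0 : (0 : ℝ) < Ideal.absNorm 𝔞 := by linarith
  have hlog : Real.log (Ideal.absNorm 𝔞) ≤ 2 * ((Ideal.absNorm 𝔞 : ℕ) : ℝ) ^ ((1 : ℝ) / 2) := by
    have := Real.log_le_rpow_div hN0.le (one_half_pos)
    rw [div_eq_mul_inv, show ((1 : ℝ) / 2)⁻¹ = 2 by norm_num] at this
    linarith
  calc Real.log (Ideal.absNorm 𝔞) / ((Ideal.absNorm 𝔞 : ℕ) : ℝ) ^ 2
      ≤ 2 * ((Ideal.absNorm 𝔞 : ℕ) : ℝ) ^ ((1 : ℝ) / 2) / ((Ideal.absNorm 𝔞 : ℕ) : ℝ) ^ 2 :=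
        div_le_div_of_nonneg_right hlog (by positivity)
    _ = 2 * ((Ideal.absNorm 𝔞 : ℕ) : ℝ) ^ (-(3 / 2 : ℝ)) := by
        rw [mul_div_assoc]
        congr 1
        rw [← Real.rpow_natCast _ 2, ← Real.rpow_sub hN0]
        norm_num

/-- **The square-free coprime harmonic sum** `∑_{0 < N𝔪 ≤ y, (𝔪,𝔠)=1, 𝔪 square-free} 1/N𝔪`: with
`d(𝔠) = ∑_{𝔢∣𝔠} μ(𝔢)/N𝔢` and the partial singular series `s_y(𝔠) = ∑_{N𝔞² ≤ y, (𝔞,𝔠)=1} μ(𝔞)/N𝔞²`,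
there are `E₀, L` (depending on `K` only) such that for every nonzero `𝔠` and `y ≥ 1`
`|∑ − ρ_K d(𝔠) s_y(𝔠) log y| ≤ E₀ · e(𝔠) + L · |d(𝔠)|`, where
`e(𝔠) = ∑_{𝔢∣𝔠} (C + ρ_K log N𝔢)/N𝔢` is the error of `abs_coprimeHarmonic_sub_le`.
(Square-free sieve `μ² = ∑_{𝔞²∣𝔪} μ(𝔞)`, regrouping `𝔪 = 𝔞²𝔫'`, the coprime harmonic sum at `y/N𝔞²`;
`E₀ = ∑ c_K(n)/n²`, `L = 4ρ_K ∑ c_K(n) n^{−3/2}`.)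
[cite: CastilloEtAl2015, §2.2 (the sums ∑_{(𝔲,𝔴)=1} μ²(𝔲)/φ(𝔲))] -/
theorem abs_sqfreeCoprimeHarmonic_sub_le :
    ∃ C E₀ L : ℝ, ∀ 𝔠 : Ideal (𝓞 K), 𝔠 ≠ ⊥ → ∀ y : ℝ, 1 ≤ y →
      |∑ 𝔪 ∈ (idealsLE K y).filter (fun 𝔪 => 𝔪 ⊔ 𝔠 = ⊤ ∧ Squarefree 𝔪),
          ((Ideal.absNorm 𝔪 : ℕ) : ℝ)⁻¹ -
          NumberField.dedekindZeta_residue K *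
            (∑ 𝔢 ∈ idealDivisors K 𝔠, (idealMoebius 𝔢 : ℝ) / Ideal.absNorm 𝔢) *
            (∑ 𝔞 ∈ (idealsLE K y).filter (fun 𝔞 =>
                ((Ideal.absNorm 𝔞 : ℕ) : ℝ) ^ 2 ≤ y ∧ 𝔞 ⊔ 𝔠 = ⊤),
              (idealMoebius 𝔞 : ℝ) / ((Ideal.absNorm 𝔞 : ℕ) : ℝ) ^ 2) * Real.log y| ≤
        E₀ * (∑ 𝔢 ∈ idealDivisors K 𝔠,
          (C + NumberField.dedekindZeta_residue K * Real.log (Ideal.absNorm 𝔢)) / Ideal.absNorm 𝔢) +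
        L * |∑ 𝔢 ∈ idealDivisors K 𝔠, (idealMoebius 𝔢 : ℝ) / Ideal.absNorm 𝔢| := by
  obtain ⟨C, hC⟩ := abs_coprimeHarmonic_sub_le K
  set ρ : ℝ := NumberField.dedekindZeta_residue K with hρ
  have hρ0 : 0 < ρ := NumberField.dedekindZeta_residue_pos K
  set Z₂ : ℝ := ∑' n, LogEulerProduct.term (idealNormCount K) 2 n with hZ₂
  set Z₃ : ℝ := ∑' n, LogEulerProduct.term (idealNormCount K) (3 / 2) n with hZ₃
  refine ⟨C, Z₂, 2 * ρ * (2 * Z₃), fun 𝔠 h𝔠 y hy => ?_⟩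
  set d : ℝ := ∑ 𝔢 ∈ idealDivisors K 𝔠, (idealMoebius 𝔢 : ℝ) / Ideal.absNorm 𝔢 with hd
  set e : ℝ := ∑ 𝔢 ∈ idealDivisors K 𝔠, (C + ρ * Real.log (Ideal.absNorm 𝔢)) / Ideal.absNorm 𝔢 with he
  set A := idealsLE K y with hA
  -- the coprime harmonic sum at height `z`
  set CH : ℝ → ℝ := fun z => ∑ 𝔫 ∈ (idealsLE K z).filter (fun 𝔫 => 𝔫 ⊔ 𝔠 = ⊤),
    ((Ideal.absNorm 𝔫 : ℕ) : ℝ)⁻¹ with hCH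
  have hCHb : ∀ z : ℝ, 1 ≤ z → |CH z - ρ * d * Real.log z| ≤ e := fun z hz => hC 𝔠 h𝔠 z hz
  have hCH0 : ∀ z : ℝ, z < 1 → CH z = 0 := by
    intro z hz
    refine Finset.sum_eq_zero fun 𝔫 h𝔫 => ?_
    exfalso
    have h1 := one_le_absNorm_of_mem_idealsLE (Finset.mem_filter.1 h𝔫).1
    have h2 := (mem_idealsLE.1 (Finset.mem_filter.1 h𝔫).1).2
    linarith
  have he0 : 0 ≤ e := (abs_nonneg _).trans (hCHb 1 le_rfl)
  -- Step 1: square-free sieve inside the sum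
  have hstep1 : ∑ 𝔪 ∈ A.filter (fun 𝔪 => 𝔪 ⊔ 𝔠 = ⊤ ∧ Squarefree 𝔪), ((Ideal.absNorm 𝔪 : ℕ) : ℝ)⁻¹ =
      ∑ 𝔪 ∈ A, ∑ 𝔞 ∈ A.filter (fun 𝔞 => 𝔞 ^ 2 ∣ 𝔪),
        (if 𝔪 ⊔ 𝔠 = ⊤ then (idealMoebius 𝔞 : ℝ) * ((Ideal.absNorm 𝔪 : ℕ) : ℝ)⁻¹ else 0) := by
    rw [Finset.sum_filter]
    refine Finset.sum_congr rfl fun 𝔪 h𝔪 => ?_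
    have h𝔪0 : 𝔪 ≠ ⊥ := (mem_idealsLE.1 h𝔪).1
    by_cases hcop : 𝔪 ⊔ 𝔠 = ⊤
    · simp only [hcop, true_and, if_true]
      rw [← Finset.sum_mul]
      have hD : ∀ 𝔞, 𝔞 ∈ A.filter (fun 𝔞 => 𝔞 ^ 2 ∣ 𝔪) ↔ 𝔞 ^ 2 ∣ 𝔪 := by
        intro 𝔞
        rw [Finset.mem_filter, hA, mem_idealsLE]
        constructor
        · exact fun h => h.2
        · intro h
          have h𝔞0 : 𝔞 ≠ ⊥ := by
            rintro rfl
            rw [← Ideal.zero_eq_bot, zero_pow two_ne_zero, zero_dvd_iff] at h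
            exact h𝔪0 h
          refine ⟨⟨h𝔞0, ?_⟩, h⟩
          have hdvd : Ideal.absNorm 𝔞 ^ 2 ∣ Ideal.absNorm 𝔪 := by
            rw [← map_pow]; exact map_dvd Ideal.absNorm h
          have hN𝔪 : Ideal.absNorm 𝔪 ≠ 0 := by rwa [Ne, Ideal.absNorm_eq_zero_iff]
          have hle := Nat.le_of_dvd (Nat.pos_of_ne_zero hN𝔪) hdvd
          have h1 : 1 ≤ Ideal.absNorm 𝔞 :=
            Nat.one_le_iff_ne_zero.2 (by rwa [Ne, Ideal.absNorm_eq_zero_iff])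
          have : Ideal.absNorm 𝔞 ≤ Ideal.absNorm 𝔞 ^ 2 := by nlinarith
          calc ((Ideal.absNorm 𝔞 : ℕ) : ℝ) ≤ Ideal.absNorm 𝔪 := by exact_mod_cast this.trans hle
            _ ≤ y := (mem_idealsLE.1 h𝔪).2
      have hμ := sum_idealMoebius_of_sq_dvd h𝔪0 hD
      have hcast : (∑ 𝔞 ∈ A.filter (fun 𝔞 => 𝔞 ^ 2 ∣ 𝔪), (idealMoebius 𝔞 : ℝ)) =
          ((∑ 𝔞 ∈ A.filter (fun 𝔞 => 𝔞 ^ 2 ∣ 𝔪), idealMoebius 𝔞 : ℤ) : ℝ) := by push_cast; rfl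
      rw [hcast, hμ]
      split_ifs <;> simp
    · simp [hcop]
  -- Step 2: regroup `𝔪 = 𝔞² 𝔫'`
  have hf : ∀ 𝔞 ∈ A, 𝔞 ^ 2 ≠ ⊥ := fun 𝔞 h𝔞 => pow_ne_zero 2 (mem_idealsLE.1 h𝔞).1
  have hstep2 := sum_idealsLE_sum_filter_map_dvd_eq hf
    (fun 𝔞 𝔪 => if 𝔪 ⊔ 𝔠 = ⊤ then (idealMoebius 𝔞 : ℝ) * ((Ideal.absNorm 𝔪 : ℕ) : ℝ)⁻¹ else 0) y
  -- Step 3: the inner sums are `[𝔞 coprime] μ(𝔞)/N𝔞² · CH(y/N𝔞²)`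
  have hstep3 : ∀ 𝔞 ∈ A, ∑ 𝔫' ∈ idealsLE K (y / Ideal.absNorm (𝔞 ^ 2)),
      (if 𝔞 ^ 2 * 𝔫' ⊔ 𝔠 = ⊤ then (idealMoebius 𝔞 : ℝ) * ((Ideal.absNorm (𝔞 ^ 2 * 𝔫') : ℕ) : ℝ)⁻¹ else 0) =
      if 𝔞 ⊔ 𝔠 = ⊤ then (idealMoebius 𝔞 : ℝ) / ((Ideal.absNorm 𝔞 : ℕ) : ℝ) ^ 2 *
        CH (y / ((Ideal.absNorm 𝔞 : ℕ) : ℝ) ^ 2) else 0 := by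
    intro 𝔞 h𝔞
    have hsq : 𝔞 ^ 2 ⊔ 𝔠 = ⊤ ↔ 𝔞 ⊔ 𝔠 = ⊤ := by
      rw [pow_two, mul_sup_eq_top_iff, and_self]
    have hN2 : ((Ideal.absNorm (𝔞 ^ 2) : ℕ) : ℝ) = ((Ideal.absNorm 𝔞 : ℕ) : ℝ) ^ 2 := by
      rw [map_pow, Nat.cast_pow]
    by_cases hcop : 𝔞 ⊔ 𝔠 = ⊤
    · rw [if_pos hcop, hCH, hN2, Finset.mul_sum, Finset.sum_filter]
      refine Finset.sum_congr rfl fun 𝔫' _ => ?_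
      by_cases h' : 𝔫' ⊔ 𝔠 = ⊤
      · have hc : 𝔞 ^ 2 * 𝔫' ⊔ 𝔠 = ⊤ := mul_sup_eq_top_iff.2 ⟨hsq.2 hcop, h'⟩
        rw [if_pos hc, if_pos h', map_mul, Nat.cast_mul, hN2, mul_inv]
        have hN := one_le_absNorm_of_mem_idealsLE h𝔞
        field_simp
      · have hc : ¬ 𝔞 ^ 2 * 𝔫' ⊔ 𝔠 = ⊤ := fun h => h' (mul_sup_eq_top_iff.1 h).2
        rw [if_neg hc, if_neg h']
    · rw [if_neg hcop]
      refine Finset.sum_eq_zero fun 𝔫' _ => ?_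
      have hc : ¬ 𝔞 ^ 2 * 𝔫' ⊔ 𝔠 = ⊤ := fun h => hcop (hsq.1 (mul_sup_eq_top_iff.1 h).1)
      rw [if_neg hc]
  rw [hstep1, hstep2, Finset.sum_congr rfl hstep3, ← Finset.sum_filter]
  -- Step 4: split according to `N𝔞² ≤ y`
  have hsplit : ∑ 𝔞 ∈ A.filter (fun 𝔞 => 𝔞 ⊔ 𝔠 = ⊤),
      (idealMoebius 𝔞 : ℝ) / ((Ideal.absNorm 𝔞 : ℕ) : ℝ) ^ 2 * CH (y / ((Ideal.absNorm 𝔞 : ℕ) : ℝ) ^ 2) =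
      ∑ 𝔞 ∈ A.filter (fun 𝔞 => ((Ideal.absNorm 𝔞 : ℕ) : ℝ) ^ 2 ≤ y ∧ 𝔞 ⊔ 𝔠 = ⊤),
        (idealMoebius 𝔞 : ℝ) / ((Ideal.absNorm 𝔞 : ℕ) : ℝ) ^ 2 * CH (y / ((Ideal.absNorm 𝔞 : ℕ) : ℝ) ^ 2) := by
    symm
    refine Finset.sum_subset (fun 𝔞 h => ?_) fun 𝔞 h𝔞 hnot => ?_
    · rw [Finset.mem_filter] at h ⊢; exact ⟨h.1, h.2.2⟩
    · rw [Finset.mem_filter] at h𝔞 hnot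
      have hgt : y < ((Ideal.absNorm 𝔞 : ℕ) : ℝ) ^ 2 := by
        by_contra hle; exact hnot ⟨h𝔞.1, not_lt.1 hle, h𝔞.2⟩
      have hN := one_le_absNorm_of_mem_idealsLE h𝔞.1
      rw [hCH0 _ ((div_lt_one (by positivity)).2 hgt), mul_zero]
  rw [hsplit, Finset.mul_sum, Finset.sum_mul, ← Finset.sum_sub_distrib]
  -- Step 5: termwise
  have hterm : ∀ 𝔞 ∈ A.filter (fun 𝔞 => ((Ideal.absNorm 𝔞 : ℕ) : ℝ) ^ 2 ≤ y ∧ 𝔞 ⊔ 𝔠 = ⊤),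
      |(idealMoebius 𝔞 : ℝ) / ((Ideal.absNorm 𝔞 : ℕ) : ℝ) ^ 2 * CH (y / ((Ideal.absNorm 𝔞 : ℕ) : ℝ) ^ 2) -
        ρ * d * ((idealMoebius 𝔞 : ℝ) / ((Ideal.absNorm 𝔞 : ℕ) : ℝ) ^ 2) * Real.log y| ≤
      (((Ideal.absNorm 𝔞 : ℕ) : ℝ) ^ 2)⁻¹ * e +
        2 * ρ * |d| * (Real.log (Ideal.absNorm 𝔞) / ((Ideal.absNorm 𝔞 : ℕ) : ℝ) ^ 2) := by
    intro 𝔞 h𝔞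
    rw [Finset.mem_filter] at h𝔞
    obtain ⟨h𝔞A, hsq, -⟩ := h𝔞
    set N : ℝ := ((Ideal.absNorm 𝔞 : ℕ) : ℝ) with hN
    have hN1 : 1 ≤ N := one_le_absNorm_of_mem_idealsLE h𝔞A
    have hN0 : 0 < N := by linarith
    have hz : 1 ≤ y / N ^ 2 := by rwa [le_div_iff₀ (by positivity), one_mul]
    have hμ : |(idealMoebius 𝔞 : ℝ)| ≤ 1 := by exact_mod_cast abs_idealMoebius_le_one 𝔞
    have hkey : |CH (y / N ^ 2) - ρ * d * Real.log y| ≤ e + 2 * ρ * |d| * Real.log N := by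
      have h1 := hCHb _ hz
      rw [Real.log_div (by linarith) (by positivity), Real.log_pow] at h1
      have : CH (y / N ^ 2) - ρ * d * Real.log y =
          (CH (y / N ^ 2) - ρ * d * (Real.log y - (2 : ℕ) * Real.log N)) - ρ * d * (2 * Real.log N) := by
        push_cast; ring
      rw [this]
      refine (abs_sub _ _).trans (add_le_add h1 ?_)
      rw [abs_mul, abs_mul, abs_of_pos hρ0, abs_of_nonneg (by positivity : (0 : ℝ) ≤ 2 * Real.log N)]
      · nlinarith [abs_nonneg d, Real.log_nonneg hN1]
    calc |(idealMoebius 𝔞 : ℝ) / N ^ 2 * CH (y / N ^ 2) - ρ * d * ((idealMoebius 𝔞 : ℝ) / N ^ 2) * Real.log y|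
        = |(idealMoebius 𝔞 : ℝ)| / N ^ 2 * |CH (y / N ^ 2) - ρ * d * Real.log y| := by
          rw [show (idealMoebius 𝔞 : ℝ) / N ^ 2 * CH (y / N ^ 2) -
              ρ * d * ((idealMoebius 𝔞 : ℝ) / N ^ 2) * Real.log y =
              (idealMoebius 𝔞 : ℝ) / N ^ 2 * (CH (y / N ^ 2) - ρ * d * Real.log y) by ring,
            abs_mul, abs_div, abs_of_pos (by positivity : (0 : ℝ) < N ^ 2)]
      _ ≤ 1 / N ^ 2 * (e + 2 * ρ * |d| * Real.log N) :=
          mul_le_mul (div_le_div_of_nonneg_right hμ (by positivity)) hkey (abs_nonneg _) (by positivity)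
      _ = (N ^ 2)⁻¹ * e + 2 * ρ * |d| * (Real.log N / N ^ 2) := by ring
  refine (Finset.abs_sum_le_sum_abs _ _).trans ((Finset.sum_le_sum hterm).trans ?_)
  rw [Finset.sum_add_distrib, ← Finset.sum_mul, ← Finset.mul_sum]
  have hsub : A.filter (fun 𝔞 => ((Ideal.absNorm 𝔞 : ℕ) : ℝ) ^ 2 ≤ y ∧ 𝔞 ⊔ 𝔠 = ⊤) ⊆ A :=
    Finset.filter_subset _ _
  have h1 : ∑ 𝔞 ∈ A.filter (fun 𝔞 => ((Ideal.absNorm 𝔞 : ℕ) : ℝ) ^ 2 ≤ y ∧ 𝔞 ⊔ 𝔠 = ⊤),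
      (((Ideal.absNorm 𝔞 : ℕ) : ℝ) ^ 2)⁻¹ ≤ Z₂ := by
    calc _ ≤ ∑ 𝔞 ∈ A, (((Ideal.absNorm 𝔞 : ℕ) : ℝ) ^ 2)⁻¹ :=
          Finset.sum_le_sum_of_subset_of_nonneg hsub fun 𝔞 _ _ => by positivity
      _ = ∑ 𝔞 ∈ A, ((Ideal.absNorm 𝔞 : ℕ) : ℝ) ^ (-(2 : ℝ)) :=
          Finset.sum_congr rfl fun 𝔞 _ => by
            rw [Real.rpow_neg (Nat.cast_nonneg _), Real.rpow_two]
      _ ≤ Z₂ := sum_idealsLE_rpow_neg_le K one_lt_two y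
  have h2 : ∑ 𝔞 ∈ A.filter (fun 𝔞 => ((Ideal.absNorm 𝔞 : ℕ) : ℝ) ^ 2 ≤ y ∧ 𝔞 ⊔ 𝔠 = ⊤),
      Real.log (Ideal.absNorm 𝔞) / ((Ideal.absNorm 𝔞 : ℕ) : ℝ) ^ 2 ≤ 2 * Z₃ := by
    calc _ ≤ ∑ 𝔞 ∈ A, Real.log (Ideal.absNorm 𝔞) / ((Ideal.absNorm 𝔞 : ℕ) : ℝ) ^ 2 :=
          Finset.sum_le_sum_of_subset_of_nonneg hsub fun 𝔞 h𝔞 _ => by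
            have := one_le_absNorm_of_mem_idealsLE h𝔞
            exact div_nonneg (Real.log_nonneg this) (by positivity)
      _ ≤ 2 * Z₃ := sum_idealsLE_log_div_sq_le K y
  have hd0 : 0 ≤ |d| := abs_nonneg d
  calc (∑ 𝔞 ∈ A.filter (fun 𝔞 => ((Ideal.absNorm 𝔞 : ℕ) : ℝ) ^ 2 ≤ y ∧ 𝔞 ⊔ 𝔠 = ⊤),
          (((Ideal.absNorm 𝔞 : ℕ) : ℝ) ^ 2)⁻¹) * e +
        2 * ρ * |d| * ∑ 𝔞 ∈ A.filter (fun 𝔞 => ((Ideal.absNorm 𝔞 : ℕ) : ℝ) ^ 2 ≤ y ∧ 𝔞 ⊔ 𝔠 = ⊤),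
          Real.log (Ideal.absNorm 𝔞) / ((Ideal.absNorm 𝔞 : ℕ) : ℝ) ^ 2
      ≤ Z₂ * e + 2 * ρ * |d| * (2 * Z₃) :=
        add_le_add (mul_le_mul_of_nonneg_right h1 he0) (mul_le_mul_of_nonneg_left h2 (by positivity))
    _ = Z₂ * e + 2 * ρ * (2 * Z₃) * |d| := by ring

end Literature.NumberTheory.LFunctions.NumberField
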